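import Mathlib.Geometry.Manifold.Diffeomorph
import Mathlib.Geometry.Manifold.Instances.Real
import Mathlib.Geometry.Euclidean.Volume.Measure
import Mathlib.MeasureTheory.Integral.Bochner.Basic
import Mathlib.Analysis.Asymptotics.Defs
import Mathlib.Analysis.Calculus.ContDiff.Basic
import Mathlib.Analysis.SpecialFunctions.Pow.Real
import Literature.Geometry.Lorentzian.Basic
import Literature.Geometry.Lorentzian.Isometry
import Literature.Geometry.Lorentzian.InitialData
import HarnessLib

-- provenance: harness21/H21/H21/Prelude/Lorentz/AsymptoticFlatness.lean @ 08f99a0 (interim HEAD d8f2665); M5 mechanical rewrite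
/-!
# Asymptotically flat ends and the ADM energy–momentum (trunk T-LORENTZ / G08, item C14)

Family `gr`, statement **gr.S15** (strong asymptotic flatness with one end; ADM mass and
energy–momentum as flux limits and their well-definedness).

Let `(X, h, k)` be a `3`-dimensional initial data set (`D : InitialDataSet (𝓡 3) X`, file
`InitialData`). An **asymptotically flat end** of `X` is an open subset `U ⊆ X` together with a
diffeomorphism `U ≅ {x : ℝ³ | ‖x‖ > R}` onto the exterior of a ball, such that the end is
*closed at infinity* in `X` (the preimages of `{‖x‖ ≥ R'}`, `R' > R`, are closed in `X`). In the
chart the metric and second fundamental form have components `h_ij, k_ij : {‖x‖ > R} → ℝ`, and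
the classical decay classes are

* `h - δ = O₂(‖x‖^{-α})`, `k = O₁(‖x‖^{-α-1})` (asymptotic flatness of order `α`; Bartnik 1986,
  Def. 2.1 in the `C^k` form; Chruściel 1986),
* `h - (1 + 2M/‖x‖) δ = o_{nh}(‖x‖^{-β})`, `k = o_{nk}(‖x‖^{-γ})` (strong asymptotic flatness
  with mass parameter `M`; Christodoulou–Klainerman 1993, (1.0.9) with `β = 3/2, γ = 5/2` and
  `nh = 4, nk = 3` derivatives; Dafermos–Rodnianski 2013, App. B.2.3 with `β = 1, γ = 2`,
  `nh = 2, nk = 1`).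

The **ADM energy** is the limit of the fluxes
`E(r) = (16π)⁻¹ ∮_{‖x‖ = r} ∑ᵢⱼ (∂ⱼ h_ij - ∂ᵢ h_jj) xⁱ/r dσ`, the **ADM momentum** is
`Pᵢ = lim (8π)⁻¹ ∮_{‖x‖ = r} ∑ⱼ (k_ij - (tr k) h_ij) xʲ/r dσ`, and the **ADM mass** is
`m = √(E² - |P|²)` (Arnowitt–Deser–Misner 1962; Bartnik 1986, (4.2)). Bartnik's theorem (CPAM 39
(1986), Thm. 4.2) asserts that for `α > 1/2` and integrable scalar curvature the energy exists and
does not depend on the choice of the end structure.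

## Main definitions (namespace `Literature.Lorentz`)

* `AFEnd X`: an asymptotically flat end (open-end design), `AFEnd.far`, `AFEnd.IsSoleEnd`.
* `AFEnd.dataChart`, `AFEnd.hCoeff`, `AFEnd.kCoeff`, `AFEnd.trKCoeff`,
  `AFEnd.scalarCurvatureCoeff`: the data read in the chart (with documented junk values inside
  the ball `‖x‖ ≤ R`).
* `AFEnd.IsSameEnd`: two end structures describe the same end (they generate the same
  neighbourhood filter of infinity; Bartnik's "structures of infinity of the same end").
* `AFEnd.IsMetricAsymptoticallyFlat`, `AFEnd.IsAsymptoticallyFlat`,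
  `AFEnd.IsStronglyAsymptoticallyFlatWith` (short alias `AFEnd.IsSAFWith` for the `o₂/o₁`
  form), `AFEnd.IsStronglyAsymptoticallyFlatCK`, `AFEnd.IsStronglyAsymptoticallyFlatDR`: decay
  classes.
* `AFEnd.partialH`, `AFEnd.admEnergyFlux`, `AFEnd.admEnergy`, `AFEnd.HasADMEnergy`,
  `AFEnd.admMomentumFlux`, `AFEnd.admMomentum`, `AFEnd.HasADMMomentum`, `AFEnd.admMass`.
* Named facts (proved in print, stated as `Prop`s): `AFEnd.HasADMEnergy_of_isAsymptoticallyFlat`,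
  `AFEnd.HasADMEnergy.Of_isSameEnd` (Bartnik 1986, Thm. 4.2) and their corollary
  `AFEnd.admEnergy_eq_of_afEnd` (taking both as hypotheses); also `AFEnd.ContDiffOn_hCoeff`,
  `AFEnd.ContDiffOn_kCoeff`, `AFEnd.IsStronglyAsymptoticallyFlatDR.IsAsymptoticallyFlat_one`.

## Mathlib

Mathlib has no asymptotic flatness or ADM quantities (`rg -i 'asymptotically flat|ADM'` finds
nothing). We use Mathlib's `Diffeomorph`, `TopologicalSpace.Opens` as manifolds, `iteratedFDeriv`,
`Asymptotics.IsBigO/IsLittleO` along `Bornology.cobounded`, `Real.rpow`, `innerSL ℝ` (the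
Euclidean form `δ`), `EuclideanSpace.single` (coordinate vectors), `fderiv`, the Bochner integral
and the **Euclidean** Hausdorff measure `MeasureTheory.Measure.euclideanHausdorffMeasure 2`
(notation `μHE[2]`, normalised to agree with Lebesgue surface measure — *not* `μH[2]`), `limUnder`.
The pullback of `h`, `k` along the chart is `Literature.Geometry.Lorentzian.pullbackBilin` (file `Isometry`).

## Design choices

* **Open-end design.** `AFEnd X` records an open `U : Opens X`, a radius `R > 0`, a
  diffeomorphism `chart : U ≅ exteriorRegion R` and closedness at infinity. A compact-core design
  (`K` compact with `Kᶜ ≅ {‖x‖ > R}`) cannot be instantiated on the horizon-penetrating Kerr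
  slices `S² × (r₀, ∞)`, whence this choice; "`X` has exactly one end" is the separate hypothesis
  `AFEnd.IsSoleEnd` (the complement of the far region is compact), as needed by the positive mass
  theorem.
* Chart components are functions on all of `E3` (so that `iteratedFDeriv`, `fderiv` and sphere
  integrals apply verbatim), extended by junk values on the closed ball `‖x‖ ≤ R`: `δ = innerSL ℝ`
  for `h`, `0` for `k`, `tr k`, `R(h)`. All decay conditions are stated along
  `Bornology.cobounded E3` and all fluxes are eventually (`r > R`) independent of the junk.
* On an open subset of `E3` the tangent spaces `TangentSpace (𝓡 3) y` are `E3` definitionally, so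
  the pulled-back forms are literally elements of `E3 →L[ℝ] E3 →L[ℝ] ℝ`.
* Decay rates use `Real.rpow` with exponent shifted by the number of derivatives
  (`O_m(r^{-α})` means `|∂^j f| = O(r^{-α-j})` for `j ≤ m`).
* `admEnergy`/`admMomentum` are `limUnder atTop` of the fluxes (junk if the limit does not exist,
  as for Mathlib's `limUnder`); the honest predicates are `HasADMEnergy`/`HasADMMomentum`.
* Integrability of the scalar curvature in Bartnik's theorem is expressed in the chart w.r.t.
  Lebesgue measure on `E3` (equivalent to `L¹(X, dμ_h)` on the end, `h` being uniformly
  equivalent to `δ` there).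

## References

* R. Arnowitt, S. Deser, C. W. Misner, *The dynamics of general relativity* (1962).
* R. Bartnik, *The mass of an asymptotically flat manifold*, CPAM 39 (1986), §1–§4, Thm. 4.2.
* P. Chruściel, *Boundary conditions at spatial infinity from a Hamiltonian point of view*
  (1986).
* D. Christodoulou, S. Klainerman, *The global nonlinear stability of the Minkowski space*
  (1993), §1, (1.0.9).
* M. Dafermos, I. Rodnianski, *Lectures on black holes and linear waves*, Clay Math. Proc. 17
  (2013), arXiv:0811.0354, App. B.2.3.
-/

open Manifold Bundle TopologicalSpace Filter Asymptotics MeasureTheory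
open scoped ContDiff Topology

noncomputable section

namespace Literature.Geometry.Lorentzian

variable (X : Type*) [TopologicalSpace X] [ChartedSpace E3 X]

/-- **gr.S15** (asymptotically flat end; Bartnik, CPAM 39 (1986), §1 and Def. 2.1;
Dafermos–Rodnianski 2013, App. B.2.3). An **asymptotically flat end** of the `3`-manifold `X`
(open-end design): an open subset `U ⊆ X`, a radius `R > 0` and a diffeomorphism
`chart : U ≅ {x : ℝ³ | R < ‖x‖}`, such that the end is **closed at infinity**: for every `R' > R`
the set `chart⁻¹ {R' ≤ ‖x‖} ⊆ X` is closed in `X` (this excludes e.g. an inverted punctured ball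
in the interior of `X` posing as an end). No decay of the data is required here; see
`AFEnd.IsAsymptoticallyFlat`, `AFEnd.IsStronglyAsymptoticallyFlatDR`. [cite: DafermosRodnianski2013, App. B.2.3] -/
structure AFEnd where
  /-- The open end `U ⊆ X`. -/
  U : Opens X
  /-- The inner coordinate radius of the end. -/
  R : ℝ
  /-- The inner radius is positive. -/
  R_pos : 0 < R
  /-- The structure at infinity: a diffeomorphism `U ≅ {x : E3 | R < ‖x‖}`. -/
  chart : Diffeomorph (𝓡 3) (𝓡 3) U (exteriorRegion R) ∞
  /-- The end is closed at infinity in `X`. -/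
  isClosed_far : ∀ R', R < R' →
    IsClosed (((↑) : U → X) '' (chart ⁻¹' {x | R' ≤ ‖(x : E3)‖}))

namespace AFEnd

variable {X}

/-- The **far region** `{R' < ‖x‖}` of the end, as a subset of `X` (image under the inverse
chart of `{x | R' < ‖x‖}`; for `R' ≤ R` it is all of `U`). Bartnik 1986, §1 (the sets `E_R`). [cite: Bartnik1986, §1 (the sets  E_R] -/
def far (e : AFEnd X) (R' : ℝ) : Set X :=
  ((↑) : e.U → X) '' (e.chart ⁻¹' {x | R' < ‖(x : E3)‖})

/-- `X` has **exactly this one (asymptotically flat) end**: the complement of some far region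
`{R' < ‖x‖}`, `R' > R`, is compact. This is the "complete, one-ended" hypothesis of the positive
mass theorem (Schoen–Yau 1979; Bartnik 1986, §4). [cite: SchoenYau1979] -/
def IsSoleEnd (e : AFEnd X) : Prop :=
  ∃ R', e.R < R' ∧ IsCompact (e.far R')ᶜ

/-- The inverse chart of the end as a map `{x : E3 | R < ‖x‖} → X` (composition of
`e.chart.symm` with the inclusion `U ↪ X`); the data are read in coordinates by pulling back
along it. Bartnik 1986, §1 ("structure of infinity" `Φ`). [cite: Bartnik1986, §1 ("structure of infinity"  Φ] -/
def dataChart (e : AFEnd X) : exteriorRegion e.R → X :=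
  fun y ↦ ((e.chart.symm y : e.U) : X)

/-- The inverse chart `dataChart e` is smooth (composition of a diffeomorphism with the
inclusion of an open submanifold). Bartnik 1986, §1. [cite: Bartnik1986, §1] -/
theorem contMDiff_dataChart (e : AFEnd X) : ContMDiff (𝓡 3) (𝓡 3) ∞ e.dataChart :=
  contMDiff_subtype_val.comp e.chart.symm.contMDiff

/-- The range of the inverse chart is the end `U`. Bartnik 1986, §1. [cite: Bartnik1986, §1] -/
theorem range_dataChart (e : AFEnd X) : Set.range e.dataChart = (e.U : Set X) := by
  ext x
  constructor
  · rintro ⟨y, rfl⟩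
    exact (e.chart.symm y).2
  · intro hx
    exact ⟨e.chart ⟨x, hx⟩, by simp [dataChart]⟩

/-- The far regions are contained in the end `U`. Bartnik 1986, §1. [cite: Bartnik1986, §1] -/
theorem far_subset (e : AFEnd X) (R' : ℝ) : e.far R' ⊆ (e.U : Set X) := by
  rintro _ ⟨y, -, rfl⟩
  exact y.2

/-- The far regions are open in `X`. Bartnik 1986, §1. [cite: Bartnik1986, §1] -/
theorem isOpen_far (e : AFEnd X) (R' : ℝ) : IsOpen (e.far R') :=
  e.U.isOpen.isOpenMap_subtype_val _
    ((isOpen_lt continuous_const continuous_subtype_val.norm).preimage e.chart.continuous)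

/-- The far regions decrease with the radius. Bartnik 1986, §1. [cite: Bartnik1986, §1] -/
theorem far_mono (e : AFEnd X) {R₁ R₂ : ℝ} (h : R₁ ≤ R₂) : e.far R₂ ⊆ e.far R₁ := by
  rintro _ ⟨y, hy, rfl⟩
  exact ⟨y, lt_of_le_of_lt h hy, rfl⟩

/-- Two end structures `e`, `e'` describe **the same end** of `X`: they generate the same
neighbourhood filter of infinity, i.e. every far region `e'.far R₂` contains some far region
`e.far R₁` and conversely. This is Bartnik's "two structures of infinity `Φ`, `Φ'` of the same
end" (Bartnik, CPAM 39 (1986), §3, Cor. 3.2 and Thm. 4.2); it excludes e.g. an end structure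
sending an *inner* topological end of `X` to infinity. [folklore] -/
def IsSameEnd (e e' : AFEnd X) : Prop :=
  (∀ R₂, ∃ R₁, e.far R₁ ⊆ e'.far R₂) ∧ (∀ R₂, ∃ R₁, e'.far R₁ ⊆ e.far R₂)

/-- Every end structure describes the same end as itself. Bartnik 1986, §3. [cite: Bartnik1986, §3] -/
theorem IsSameEnd.refl (e : AFEnd X) : IsSameEnd e e :=
  ⟨fun R₂ ↦ ⟨R₂, subset_rfl⟩, fun R₂ ↦ ⟨R₂, subset_rfl⟩⟩

/-- `IsSameEnd` is symmetric. Bartnik 1986, §3. [cite: Bartnik1986, §3] -/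
theorem IsSameEnd.symm {e e' : AFEnd X} (h : IsSameEnd e e') : IsSameEnd e' e :=
  ⟨h.2, h.1⟩

/-- `IsSameEnd` is transitive. Bartnik 1986, §3. [cite: Bartnik1986, §3] -/
theorem IsSameEnd.trans {e e' e'' : AFEnd X} (h : IsSameEnd e e') (h' : IsSameEnd e' e'') :
    IsSameEnd e e'' := by
  refine ⟨fun R₂ ↦ ?_, fun R₂ ↦ ?_⟩
  · obtain ⟨R₁, h₁⟩ := h'.1 R₂
    obtain ⟨R₀, h₀⟩ := h.1 R₁
    exact ⟨R₀, h₀.trans h₁⟩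
  · obtain ⟨R₁, h₁⟩ := h.2 R₂
    obtain ⟨R₀, h₀⟩ := h'.2 R₁
    exact ⟨R₀, h₀.trans h₁⟩

variable [IsManifold (𝓡 3) ∞ X] (e : AFEnd X) (D : InitialDataSet (𝓡 3) X)

/-- The **chart components of the metric**: for `R < ‖x‖`, `hCoeff e D x` is the pullback
`(Φ^* h)_x ∈ E3 →L[ℝ] E3 →L[ℝ] ℝ` of `h` along the inverse chart `Φ = dataChart e` (so
`h_ij(x) = hCoeff e D x eᵢ eⱼ`); inside the closed ball `‖x‖ ≤ R` it is the **junk value**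
`δ = innerSL ℝ` (irrelevant for all decay conditions, which live at infinity). Bartnik 1986, §1,
(1.3); Dafermos–Rodnianski 2013, App. B.2.3. [cite: Bartnik1986, §1  (1.3] -/
def hCoeff (x : E3) : E3 →L[ℝ] E3 →L[ℝ] ℝ :=
  if hx : e.R < ‖x‖ then
    pullbackBilin (I := 𝓡 3) (I' := 𝓡 3) e.dataChart D.h.inner ⟨x, hx⟩
  else innerSL ℝ

/-- The **chart components of the second fundamental form**: for `R < ‖x‖`, `kCoeff e D x` is
the pullback `(Φ^* k)_x` of `k` along the inverse chart; inside the closed ball `‖x‖ ≤ R` it is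
the **junk value** `0`. Christodoulou–Klainerman 1993, (1.0.9); Dafermos–Rodnianski 2013,
App. B.2.3. [cite: ChristodoulouKlainerman1993, (1.0.9] -/
def kCoeff (x : E3) : E3 →L[ℝ] E3 →L[ℝ] ℝ :=
  if hx : e.R < ‖x‖ then
    pullbackBilin (I := 𝓡 3) (I' := 𝓡 3) e.dataChart D.k ⟨x, hx⟩
  else 0

/-- The **mean curvature `tr_h k` read in the chart**: `trKCoeff e D x = (tr_h k)(Φ x)` for
`R < ‖x‖` (a scalar, so no pullback is needed), junk value `0` inside the ball. Bartnik 1986,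
§4; Arnowitt–Deser–Misner 1962. [cite: Bartnik1986, §4] -/
def trKCoeff (x : E3) : ℝ :=
  if hx : e.R < ‖x‖ then D.traceK (e.dataChart ⟨x, hx⟩) else 0

/-- The **scalar curvature `R(h)` read in the chart**: `R(h)(Φ x)` for `R < ‖x‖`, junk value `0`
inside the ball. Used to express Bartnik's integrability hypothesis `R(h) ∈ L¹` (standing
hypothesis `[D.metric.HasLeviCivita]` of the curvature API, file `InitialData`). Bartnik 1986,
Thm. 4.2. [cite: Bartnik1986, Thm. 4.2] -/
def scalarCurvatureCoeff [D.metric.HasLeviCivita] (x : E3) : ℝ :=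
  if hx : e.R < ‖x‖ then D.metric.scalarCurvature (e.dataChart ⟨x, hx⟩) else 0

/-- Outside the ball, `hCoeff` is the pullback of `h` along the inverse chart. Bartnik 1986,
(1.3). [cite: Bartnik1986, (1.3] -/
theorem hCoeff_of_lt {e : AFEnd X} (D : InitialDataSet (𝓡 3) X) {x : E3} (hx : e.R < ‖x‖) :
    hCoeff e D x = pullbackBilin (I := 𝓡 3) (I' := 𝓡 3) e.dataChart D.h.inner ⟨x, hx⟩ :=
  dif_pos hx

/-- Outside the ball, `kCoeff` is the pullback of `k` along the inverse chart.
Christodoulou–Klainerman 1993, (1.0.9). [cite: ChristodoulouKlainerman1993, (1.0.9] -/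
theorem kCoeff_of_lt {e : AFEnd X} (D : InitialDataSet (𝓡 3) X) {x : E3} (hx : e.R < ‖x‖) :
    kCoeff e D x = pullbackBilin (I := 𝓡 3) (I' := 𝓡 3) e.dataChart D.k ⟨x, hx⟩ :=
  dif_pos hx

/-- The chart components `h_ij` are symmetric (everywhere, the junk value `δ` being symmetric
too). Bartnik 1986, §1. [cite: Bartnik1986, §1] -/
theorem hCoeff_symm (x : E3) (v w : E3) : hCoeff e D x v w = hCoeff e D x w v := by
  unfold hCoeff
  split_ifs with hx
  · exact D.h.symm _ _ _
  · change inner ℝ v w = inner ℝ w v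
    exact real_inner_comm _ _

/-- The chart components `k_ij` are symmetric. Christodoulou–Klainerman 1993, §1. [cite: ChristodoulouKlainerman1993, §1] -/
theorem kCoeff_symm (x : E3) (v w : E3) : kCoeff e D x v w = kCoeff e D x w v := by
  unfold kCoeff
  split_ifs with hx
  · exact D.k_symm _ _ _
  · rfl

/-- The chart components of `h` are smooth on the open exterior region `{R < ‖x‖}` (pullback of
a smooth metric along a smooth map). Bartnik 1986, §1. [cite: Bartnik1986, §1] -/
def ContDiffOn_hCoeff : Prop :=
  ContDiffOn ℝ ∞ (hCoeff e D) {x | e.R < ‖x‖}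

/-- The chart components of `k` are smooth on the open exterior region `{R < ‖x‖}`.
Christodoulou–Klainerman 1993, §1. [cite: ChristodoulouKlainerman1993, §1] -/
def ContDiffOn_kCoeff : Prop :=
  ContDiffOn ℝ ∞ (kCoeff e D) {x | e.R < ‖x‖}

/-! ### Decay classes -/

/-- Slower power decay dominates faster power decay at infinity: `‖x‖ ^ p = O(‖x‖ ^ q)` along
`Bornology.cobounded` for `p ≤ q` (indeed `‖x‖ ^ p ≤ ‖x‖ ^ q` once `1 ≤ ‖x‖`). [folklore] -/
theorem isBigO_norm_rpow_cobounded {p q : ℝ} (h : p ≤ q) :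
    (fun x : E3 ↦ ‖x‖ ^ p) =O[Bornology.cobounded E3] fun x ↦ ‖x‖ ^ q := by
  refine IsBigO.of_bound 1 ?_
  filter_upwards [eventually_cobounded_le_norm (E := E3) 1] with x hx
  rw [one_mul, Real.norm_of_nonneg (Real.rpow_nonneg (norm_nonneg _) _),
    Real.norm_of_nonneg (Real.rpow_nonneg (norm_nonneg _) _)]
  exact Real.rpow_le_rpow_of_exponent_le hx h

/-- **Asymptotic flatness of order `α` of the metric** (in the `C²` form): in the chart of the
end, `h_ij - δ_ij = O₂(‖x‖^{-α})`, i.e. `|∂^m (h - δ)(x)| = O(‖x‖^{-α-m})` for `m ≤ 2` as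
`‖x‖ → ∞` (`iteratedFDeriv` along `Bornology.cobounded E3`; no condition on `k`). This is the
hypothesis of Bartnik's mass theorem. Bartnik, CPAM 39 (1986), Def. 2.1 (`C²` form) and Thm. 4.2. [folklore] -/
def IsMetricAsymptoticallyFlat (α : ℝ) : Prop :=
  ∀ m : ℕ, m ≤ 2 →
    (fun x ↦ ‖iteratedFDeriv ℝ m
        (fun y ↦ hCoeff e D y - (innerSL ℝ : E3 →L[ℝ] E3 →L[ℝ] ℝ)) x‖)
      =O[Bornology.cobounded E3] fun x ↦ ‖x‖ ^ (-α - m)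

/-- **Asymptotic flatness of order `α`** (in the `C²`/`C¹` form): in the chart of the end,
`h_ij - δ_ij = O₂(‖x‖^{-α})` and `k_ij = O₁(‖x‖^{-α-1})`, i.e.
`|∂^m (h - δ)(x)| = O(‖x‖^{-α-m})` for `m ≤ 2` and `|∂^m k(x)| = O(‖x‖^{-α-1-m})` for `m ≤ 1`
as `‖x‖ → ∞` (`iteratedFDeriv` along `Bornology.cobounded E3`). It is the conjunction of the
metric part `IsMetricAsymptoticallyFlat` (all that Bartnik's mass theorem needs) and the `k` part.
Bartnik, CPAM 39 (1986), Def. 2.1 and §4 (with `k` added as in Chruściel 1986; Bartnik–Isenberg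
2004, §2); the classical PMT uses `α = 1`, Bartnik's mass theorem `α > 1/2`. [folklore] -/
def IsAsymptoticallyFlat (α : ℝ) : Prop :=
  IsMetricAsymptoticallyFlat e D α ∧
  (∀ m : ℕ, m ≤ 1 →
    (fun x ↦ ‖iteratedFDeriv ℝ m (kCoeff e D) x‖) =O[Bornology.cobounded E3]
      fun x ↦ ‖x‖ ^ (-α - 1 - m))

/-- Asymptotic flatness of order `α` contains the metric decay `h - δ = O₂(r^{-α})`.
Bartnik 1986, Def. 2.1. [cite: Bartnik1986, Def. 2.1] -/
theorem IsAsymptoticallyFlat.isMetricAsymptoticallyFlat {e : AFEnd X}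
    {D : InitialDataSet (𝓡 3) X} {α : ℝ} (h : IsAsymptoticallyFlat e D α) :
    IsMetricAsymptoticallyFlat e D α :=
  h.1

/-- **Strong asymptotic flatness with mass parameter `M`, rates `(β, γ)` and derivative counts
`(nh, nk)`**: in the chart of the end, `h_ij - (1 + 2M/‖x‖) δ_ij = o_{nh}(‖x‖^{-β})` and
`k_ij = o_{nk}(‖x‖^{-γ})`, i.e. `|∂^m (h - (1 + 2M/r) δ)(x)| = o(‖x‖^{-β-m})` for `m ≤ nh` and
`|∂^m k(x)| = o(‖x‖^{-γ-m})` for `m ≤ nk` as `‖x‖ → ∞` (`2M/‖0‖` is a junk value at the origin,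
invisible along `Bornology.cobounded`). Christodoulou–Klainerman 1993, (1.0.9)
(`β = 3/2, γ = 5/2, nh = 4, nk = 3`); Dafermos–Rodnianski 2013, App. B.2.3
(`β = 1, γ = 2, nh = 2, nk = 1`). [cite: ChristodoulouKlainerman1993, (1.0.9] -/
def IsStronglyAsymptoticallyFlatWith (M β γ : ℝ) (nh nk : ℕ) : Prop :=
  (∀ m : ℕ, m ≤ nh →
    (fun x ↦ ‖iteratedFDeriv ℝ m
        (fun y ↦ hCoeff e D y - (1 + 2 * M / ‖y‖) • (innerSL ℝ : E3 →L[ℝ] E3 →L[ℝ] ℝ)) x‖)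
      =o[Bornology.cobounded E3] fun x ↦ ‖x‖ ^ (-β - m)) ∧
  (∀ m : ℕ, m ≤ nk →
    (fun x ↦ ‖iteratedFDeriv ℝ m (kCoeff e D) x‖) =o[Bornology.cobounded E3]
      fun x ↦ ‖x‖ ^ (-γ - m))

/-- **Strong asymptotic flatness with mass parameter `M` and rates `(β, γ)`** in the `o₂/o₁`
form: `h_ij - (1 + 2M/‖x‖) δ_ij = o₂(‖x‖^{-β})` and `k_ij = o₁(‖x‖^{-γ})` (short name kept from
the architect's outline; it abbreviates `IsStronglyAsymptoticallyFlatWith e D M β γ 2 1`).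
Dafermos–Rodnianski 2013, App. B.2.3 (`β = 1`, `γ = 2`). [cite: DafermosRodnianski2013, App. B.2.3 ( β = 1    γ = 2] -/
abbrev IsSAFWith (M β γ : ℝ) : Prop :=
  IsStronglyAsymptoticallyFlatWith e D M β γ 2 1

/-- Decreasing the derivative counts weakens strong asymptotic flatness.
Christodoulou–Klainerman 1993, (1.0.9). [cite: ChristodoulouKlainerman1993, (1.0.9] -/
theorem IsStronglyAsymptoticallyFlatWith.mono_count {e : AFEnd X} {D : InitialDataSet (𝓡 3) X}
    {M β γ : ℝ} {nh nk nh' nk' : ℕ} (h : IsStronglyAsymptoticallyFlatWith e D M β γ nh nk)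
    (hh : nh' ≤ nh) (hk : nk' ≤ nk) : IsStronglyAsymptoticallyFlatWith e D M β γ nh' nk' :=
  ⟨fun m hm ↦ h.1 m (hm.trans hh), fun m hm ↦ h.2 m (hm.trans hk)⟩

/-- **Strong asymptotic flatness in the sense of Christodoulou–Klainerman**:
`h_ij = (1 + 2M/r) δ_ij + o₄(r^{-3/2})`, `k_ij = o₃(r^{-5/2})` in the chart of the end (four
resp. three derivatives controlled, exactly as in the source). Christodoulou–Klainerman,
*The global nonlinear stability of the Minkowski space* (1993), §1, (1.0.9). [folklore] -/
def IsStronglyAsymptoticallyFlatCK (M : ℝ) : Prop :=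
  IsStronglyAsymptoticallyFlatWith e D M (3 / 2) (5 / 2) 4 3

/-- **gr.S15** (strong asymptotic flatness; Dafermos–Rodnianski, Clay lectures (2013),
App. B.2.3; Christodoulou–Klainerman 1993, §1). The data are **strongly asymptotically flat with
mass `M`** on the end `e`: `h_ij = (1 + 2M/r) δ_ij + o₂(r⁻¹)` and `k_ij = o₁(r⁻²)` in the chart of
the end (the inventory's version). "With one end" is the separate hypothesis `AFEnd.IsSoleEnd`. [cite: ChristodoulouKlainerman1993, §1] -/
def IsStronglyAsymptoticallyFlatDR (M : ℝ) : Prop :=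
  IsStronglyAsymptoticallyFlatWith e D M 1 2 2 1

/-- CK-strong asymptotic flatness implies DR-strong asymptotic flatness (the CK rates are
faster). Christodoulou–Klainerman 1993, (1.0.9); Dafermos–Rodnianski 2013, App. B.2.3. [cite: ChristodoulouKlainerman1993, (1.0.9] -/
theorem IsStronglyAsymptoticallyFlatCK.isStronglyAsymptoticallyFlatDR {e : AFEnd X}
    {D : InitialDataSet (𝓡 3) X} {M : ℝ} (h : IsStronglyAsymptoticallyFlatCK e D M) :
    IsStronglyAsymptoticallyFlatDR e D M :=
  ⟨fun m hm ↦ (h.1 m (by omega)).trans_isBigO (isBigO_norm_rpow_cobounded (by linarith)),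
    fun m hm ↦ (h.2 m (by omega)).trans_isBigO (isBigO_norm_rpow_cobounded (by linarith))⟩

/-- DR-strong asymptotic flatness is `IsSAFWith` with rates `(1, 2)` (by definition).
Dafermos–Rodnianski 2013, App. B.2.3. [cite: DafermosRodnianski2013, App. B.2.3] -/
theorem isStronglyAsymptoticallyFlatDR_iff {e : AFEnd X} {D : InitialDataSet (𝓡 3) X} {M : ℝ} :
    IsStronglyAsymptoticallyFlatDR e D M ↔ IsSAFWith e D M 1 2 :=
  Iff.rfl

/-- DR-strong asymptotic flatness with mass `M` implies asymptotic flatness of order `1`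
(`2M/r · δ = O₂(r⁻¹)`). Named fact (the print proof estimates two derivatives of
`x ↦ ‖x‖⁻¹`). Dafermos–Rodnianski 2013, App. B.2.3; Bartnik 1986, Def. 2.1. [cite: DafermosRodnianski2013, App. B.2.3] -/
def IsStronglyAsymptoticallyFlatDR.IsAsymptoticallyFlat_one : Prop :=
  ∀ {M : ℝ}, IsStronglyAsymptoticallyFlatDR e D M → IsAsymptoticallyFlat e D 1

/-! ### ADM energy, momentum and mass -/

/-- The coordinate partial derivative `∂ₗ h_ij (x)` of the chart component
`h_ij = hCoeff e D · eᵢ eⱼ` in the direction `eₗ`, where `eᵢ = EuclideanSpace.single i 1` is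
Mathlib's standard basis of `E3` (Fréchet derivative `fderiv ℝ` evaluated on `eₗ`; junk `0` where
not differentiable, in particular meaningful only for `R < ‖x‖`). Bartnik 1986, (4.2). [cite: Bartnik1986, (4.2] -/
def partialH (l i j : Fin 3) (x : E3) : ℝ :=
  fderiv ℝ (fun y ↦ hCoeff e D y (EuclideanSpace.single i 1) (EuclideanSpace.single j 1)) x
    (EuclideanSpace.single l 1)

/-- The **ADM energy flux** through the coordinate sphere of radius `r`:
`E(r) = (16π)⁻¹ ∫_{‖x‖ = r} ∑ᵢⱼ (∂ⱼ h_ij - ∂ᵢ h_jj)(x) · xⁱ/r dσ(x)`, where `σ = μHE[2]` is the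
Euclidean `2`-dimensional Hausdorff (surface) measure on `E3`. Meaningful for `r > R`.
Arnowitt–Deser–Misner 1962; Bartnik, CPAM 39 (1986), (4.2). [cite: ArnowittDeserMisner1962] -/
def admEnergyFlux (r : ℝ) : ℝ :=
  (16 * Real.pi)⁻¹ *
    ∫ x in Metric.sphere (0 : E3) r,
      ∑ i : Fin 3, ∑ j : Fin 3, (partialH e D j i j x - partialH e D i j j x) * x i / r
      ∂(μHE[2] : Measure E3)

/-- The data have **ADM energy `m`** on the end `e`: the fluxes `E(r)` converge to `m` as
`r → ∞`. Bartnik, CPAM 39 (1986), (4.2) and Thm. 4.2. [folklore] -/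
def HasADMEnergy (m : ℝ) : Prop :=
  Tendsto (admEnergyFlux e D) atTop (𝓝 m)

/-- The **ADM energy** `E = lim_{r → ∞} E(r)` of the end (Mathlib's `limUnder`; a **junk value**
if the limit does not exist — use `HasADMEnergy` for the honest statement; existence is
`hasADMEnergy_of_isAsymptoticallyFlat`). Arnowitt–Deser–Misner 1962; Bartnik 1986, (4.2). [cite: ArnowittDeserMisner1962] -/
def admEnergy : ℝ :=
  limUnder atTop (admEnergyFlux e D)

/-- The **ADM momentum flux** (component `i`) through the coordinate sphere of radius `r`:
`Pᵢ(r) = (8π)⁻¹ ∫_{‖x‖ = r} ∑ⱼ (k_ij - (tr_h k) h_ij)(x) · xʲ/r dσ(x)`, `σ = μHE[2]`.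
Arnowitt–Deser–Misner 1962; Bartnik–Isenberg 2004, §2; Christodoulou–Klainerman 1993, §1. [cite: ArnowittDeserMisner1962] -/
def admMomentumFlux (i : Fin 3) (r : ℝ) : ℝ :=
  (8 * Real.pi)⁻¹ *
    ∫ x in Metric.sphere (0 : E3) r,
      ∑ j : Fin 3, (kCoeff e D x (EuclideanSpace.single i 1) (EuclideanSpace.single j 1)
        - trKCoeff e D x *
          hCoeff e D x (EuclideanSpace.single i 1) (EuclideanSpace.single j 1)) * x j / r
      ∂(μHE[2] : Measure E3)

/-- The data have **ADM momentum `p`** (component `i`) on the end `e`: the fluxes `Pᵢ(r)`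
converge to `p`. Arnowitt–Deser–Misner 1962; Bartnik–Isenberg 2004, §2. [cite: ArnowittDeserMisner1962] -/
def HasADMMomentum (i : Fin 3) (p : ℝ) : Prop :=
  Tendsto (admMomentumFlux e D i) atTop (𝓝 p)

/-- The **ADM linear momentum** `Pᵢ = lim_{r → ∞} Pᵢ(r)` of the end (`limUnder`; junk value if
the limit does not exist, see `HasADMMomentum`). Arnowitt–Deser–Misner 1962; Bartnik–Isenberg
2004, §2. [cite: ArnowittDeserMisner1962] -/
def admMomentum (i : Fin 3) : ℝ :=
  limUnder atTop (admMomentumFlux e D i)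

/-- **gr.S15** (ADM mass; Arnowitt–Deser–Misner 1962; Bartnik, CPAM 39 (1986), Thm. 4.2;
Christodoulou–Klainerman 1993, §1). The **ADM mass** `m = √(E² - |P|²)` of the end, with `E` the
ADM energy and `P` the ADM linear momentum (`Real.sqrt`, hence `0` if `E² < |P|²`, which the
positive mass theorem excludes under the dominant energy condition). [cite: ArnowittDeserMisner1962] -/
def admMass : ℝ :=
  Real.sqrt (admEnergy e D ^ 2 - ∑ i : Fin 3, admMomentum e D i ^ 2)

/-- If the data have ADM energy `m`, then `admEnergy = m`. Bartnik 1986, (4.2). [cite: Bartnik1986, (4.2] -/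
theorem HasADMEnergy.admEnergy_eq {e : AFEnd X} {D : InitialDataSet (𝓡 3) X} {m : ℝ}
    (h : HasADMEnergy e D m) : admEnergy e D = m :=
  h.limUnder_eq

/-- If the data have ADM momentum `p` in direction `i`, then `admMomentum i = p`.
Bartnik–Isenberg 2004, §2. [cite: BartnikIsenberg2004, §2] -/
theorem HasADMMomentum.admMomentum_eq {e : AFEnd X} {D : InitialDataSet (𝓡 3) X} {i : Fin 3}
    {p : ℝ} (h : HasADMMomentum e D i p) : admMomentum e D i = p :=
  h.limUnder_eq

/-- For time-symmetric data (`k = 0`) all ADM momentum fluxes vanish beyond the inner radius,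
so the ADM momentum is `0`. Bartnik–Isenberg 2004, §2. [cite: BartnikIsenberg2004, §2] -/
theorem hasADMMomentum_zero_of_isTimeSymmetric {D : InitialDataSet (𝓡 3) X}
    (hD : D.IsTimeSymmetric) (i : Fin 3) : HasADMMomentum e D i 0 := by
  have hk : ∀ x, kCoeff e D x = 0 := by
    intro x
    unfold kCoeff
    split_ifs with hx
    · ext v w
      change D.k (e.dataChart ⟨x, hx⟩) _ _ = 0
      rw [hD]
      rfl
    · rfl
  have htr : ∀ x, trKCoeff e D x = 0 := by
    intro x
    unfold trKCoeff
    split_ifs with hx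
    · exact hD.isMaximalData _
    · rfl
  have hflux : admMomentumFlux e D i = fun _ ↦ 0 := by
    funext r
    simp [admMomentumFlux, hk, htr]
  change Tendsto (admMomentumFlux e D i) atTop (𝓝 0)
  rw [hflux]
  exact tendsto_const_nhds

/-- **Bartnik's existence theorem for the ADM energy** (Bartnik, CPAM 39 (1986), Thm. 4.2 and
Prop. 4.1): if the metric is asymptotically flat of order `α > 1/2` on the end `e` (`C²` decay
of order `α` embeds in Bartnik's weighted Sobolev class `W^{2,q}_{-τ}`, `1/2 < τ < α`) and the
scalar curvature `R(h)` is integrable on the end (in the chart, w.r.t. Lebesgue measure, beyond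
some radius `R' ≥ R`), then the ADM energy fluxes converge, i.e. the ADM energy exists. No
condition on `k` is needed. Named fact. [cite: Bartnik1986, Thm. 4.2 and Prop. 4.1] -/
def HasADMEnergy_of_isAsymptoticallyFlat [D.metric.HasLeviCivita] : Prop :=
  ∀ {α : ℝ}, 1 / 2 < α → IsMetricAsymptoticallyFlat e D α → ∀ {R' : ℝ}, e.R ≤ R' →
    IntegrableOn (scalarCurvatureCoeff e D) {x | R' < ‖x‖} volume → ∃ m, HasADMEnergy e D m

/-- **Bartnik's uniqueness theorem for the ADM energy** (Bartnik, CPAM 39 (1986), Thm. 4.2 with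
Cor. 3.2; Chruściel 1986): the ADM energy does not depend on the structure at infinity. If `e`,
`e'` are two end structures of the *same* end of `X` (`IsSameEnd e e'`), in both of which the
metric is asymptotically flat of order `α > 1/2`, with integrable scalar curvature on the end, and
the fluxes of `e` converge to `m`, then so do the fluxes of `e'`. Named fact. [cite: Bartnik1986, Thm. 4.2 and Cor. 3.2] -/
def HasADMEnergy.Of_isSameEnd [D.metric.HasLeviCivita] : Prop :=
  ∀ {e e' : AFEnd X} {m : ℝ}, HasADMEnergy e D m → IsSameEnd e e' → ∀ {α : ℝ}, 1 / 2 < α →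
    IsMetricAsymptoticallyFlat e D α → IsMetricAsymptoticallyFlat e' D α → ∀ {R' : ℝ}, e.R ≤ R' →
    IntegrableOn (scalarCurvatureCoeff e D) {x | R' < ‖x‖} volume → HasADMEnergy e' D m

/-- **Bartnik's uniqueness theorem for the ADM energy**, `admEnergy` form (Bartnik, CPAM 39
(1986), Thm. 4.2; Chruściel 1986): two end structures of the same end, both metrically
asymptotically flat of order `α > 1/2` with integrable scalar curvature, have the same ADM energy
(the limit exists by the named fact `HasADMEnergy_of_isAsymptoticallyFlat`, so no junk value of
`limUnder` is involved; uniqueness is the named fact `HasADMEnergy.Of_isSameEnd`, both threaded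
as hypotheses). [cite: Bartnik1986, Thm. 4.2] -/
theorem admEnergy_eq_of_afEnd {e e' : AFEnd X} {D : InitialDataSet (𝓡 3) X}
    [D.metric.HasLeviCivita] (hex : HasADMEnergy_of_isAsymptoticallyFlat e D)
    (huniq : HasADMEnergy.Of_isSameEnd D)
    (hee' : IsSameEnd e e') {α : ℝ} (hα : 1 / 2 < α)
    (hAF : IsMetricAsymptoticallyFlat e D α) (hAF' : IsMetricAsymptoticallyFlat e' D α)
    {R' : ℝ} (hR' : e.R ≤ R')
    (hint : IntegrableOn (scalarCurvatureCoeff e D) {x | R' < ‖x‖} volume) :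
    admEnergy e D = admEnergy e' D := by
  obtain ⟨m, hm⟩ := hex hα hAF hR' hint
  rw [hm.admEnergy_eq, (huniq hm hee' hα hAF hAF' hR' hint).admEnergy_eq]

end AFEnd

end Literature.Geometry.Lorentzian

end
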